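import Literature.Analysis.FluidPDE.PeriodicCylinderNeumannFrameWordsAll
import Literature.Analysis.FluidPDE.PeriodicCylinderWordNorms
import HarnessLib

/-!
# Frame words versus the tree's Sobolev word sums on the period cell

Topic `Literature/Analysis/FluidPDE`. Support file (all results proved, no definitions, no named
facts). The general-order Neumann estimates of `PeriodicCylinderNeumannFrameWordsAll` are stated with
the sizes `frameSize n f = Σ_{l+j+e ≤ n} ‖P^l J^j E^e f‖_{L²(cell)}` and
`tanSize n f = Σ_{j+e ≤ n} ‖∇ J^j E^e f‖_{L²(cell)}` (`P = x_h·∇`, `J = ∂_θ`, `E = ∂_z`, derivatives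
within the closed cylinder), whereas the tree's Sobolev norm `‖f‖_{W^{n,2}(cell)}` of a function smooth
on the closed cylinder is the word sum `𝒩_n(f) = Σ_{m ≤ n} Σ_{w : Fin m → ι} ‖X_{e∘w} f‖_{L²(cell)}` over
the basis `e = Module.finBasis ℝ ℝ³` (`toReal_eSobolevDomainNorm_eq_wordSum`, `PeriodicCylinderWordNorms`).
This file bounds the former by the latter:

* `exists_coeff_cylWord_replicate_P_smul` — for a coefficient `φ` with `Pφ = φ` (the linear
  functions of `x_h`), `P^i(φ h) = φ Σ_{l ≤ i} c_{i,l} P^l h` with universal coefficients;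
* `exists_norm_cylWord_replicate_P_le` — **pointwise**, `‖P^l g (x)‖ ≤ C_a Σ_{m ≤ a} Σ_w ‖X_{e∘w} g (x)‖`
  on the closed cylinder for `l ≤ a` (expand the innermost `P = Σ_k ℓ_k(x_h) ∂_{e_k}`, pass the
  eigen-coefficients `ℓ_k(x_h)` through the remaining `P`'s, induction);
* `exists_cellL2_replicate_P_jcWord_le` — `‖P^a X_{wd} f‖_{L²(cell)} ≤ C M^N 𝒩_N(f)` for words `wd`
  over `{J} ∪ {constants of norm ≤ M}` with `a + |wd| ≤ N` (the previous bound and the tree's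
  `exists_cellL2_cylWord_jcWord_le`);
* `exists_frameSize_le_wordSum`, `exists_tanSize_le_wordSum` — **`frameSize n f ≤ C 𝒩_n(f)` and
  `tanSize n f ≤ C 𝒩_{n+1}(f)`** for all `f` smooth on the closed cylinder.

These are the conversions needed to state the general-order `H^k` estimate of the Neumann problem /
Helmholtz projector on the periodic cylinder in the tree's Sobolev norms (T. Kato, C. Y. Lai,
J. Funct. Anal. 56 (1984) §4 (i); the analytic input of
`Literature.Analysis.FluidPDE.KatoLai1984_periodicCylinderUniformExistence`). All statements are
folklore calculus.

Mathlib/tree search: `cylDeriv_eq_sum_coord_mul`, `norm_cylDeriv_le_sum_coord`,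
`exists_cellL2_cylWord_jcWord_le`, `cylWord_constWord_cylDeriv`, `sum_fin_zero_fun`, `sum_fin_succ_fun`,
`tanWord_eq_jcWord`, `cellL2_cylGrad_le_sum` (tree); nothing for the alphabet with `P`
(`lean search 'frameSize|replicate.*horizontalProj'`).

## References

* T. Kato, C. Y. Lai, J. Funct. Anal. 56 (1984) 15–28, §4 (i). [KatoLai1984]
* A. B. Ferrari, Comm. Math. Phys. 155 (1993), Lemma 2 pp. 280–281. [Ferrari1993]
-/

noncomputable section

open MeasureTheory Set Function Filter Topology TopologicalSpace WithLp Metric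
open scoped ContDiff NNReal ENNReal InnerProductSpace RealInnerProductSpace

namespace Literature.Analysis.FluidPDE

open Literature.Analysis.FunctionSpaces

/-- Local notation for physical space `ℝ³ = EuclideanSpace ℝ (Fin 3)`. -/
local notation "ℝ³" => EuclideanSpace ℝ (Fin 3)

/-- Local notation for the closed unit cylinder `{r ≤ 1}`. -/
local notation "𝕂" => closure (SetLike.coe unitCylinder : Set (EuclideanSpace ℝ (Fin 3)))

/-- Local notation for the radial field `P = x_h`. -/
local notation "Pf" => (fun y : EuclideanSpace ℝ (Fin 3) => horizontalProj y)

/-- Local notation for the axial field `E = e₂`. -/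
local notation "Ef" => (fun _ : EuclideanSpace ℝ (Fin 3) => cylBasis 2)

/-- Local notation for the sorted frame word `P^a J^j E^e`. -/
local notation "pje[" a "," j "," e "]" =>
  (List.replicate a Pf ++ List.replicate j rotGen ++ List.replicate e Ef)

variable {F : Type*} [NormedAddCommGroup F] [NormedSpace ℝ F]

/-! ### Powers of `P` through an eigen-coefficient -/

/-- The letters of `P^i` are smooth. [folklore] -/
theorem contDiff_of_mem_replicate_P (i : ℕ) : ∀ V ∈ List.replicate i Pf, ContDiff ℝ ∞ V := fun V hV => by
  rw [List.eq_of_mem_replicate hV]; exact contDiff_horizontalProj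

/-- `P^i (f + g) = P^i f + P^i g` on the closed cylinder. [folklore] -/
theorem cylWord_replicate_P_add (i : ℕ) {f g : ℝ³ → F} (hf : ContDiffOn ℝ ∞ f 𝕂) (hg : ContDiffOn ℝ ∞ g 𝕂) :
    EqOn (cylWord (List.replicate i Pf) (fun x => f x + g x))
      (fun x => cylWord (List.replicate i Pf) f x + cylWord (List.replicate i Pf) g x) 𝕂 := by
  induction i with
  | zero => intro x _; rfl
  | succ i ih =>
    intro x hx
    simp only [List.replicate_succ, cylWord_cons]
    rw [cylDeriv_congr ih hx]
    exact cylDeriv_add (contDiffOn_cylWord (contDiff_of_mem_replicate_P i) hf)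
      (contDiffOn_cylWord (contDiff_of_mem_replicate_P i) hg) hx

/-- `P^i 0 = 0` on the closed cylinder. [folklore] -/
theorem cylWord_replicate_P_zero (i : ℕ) : EqOn (cylWord (List.replicate i Pf) (fun _ : ℝ³ => (0 : F))) (fun _ => 0) 𝕂 := by
  induction i with
  | zero => intro x _; rfl
  | succ i ih =>
    intro x hx
    rw [List.replicate_succ, cylWord_cons, cylDeriv_congr ih hx, cylDeriv_const]

/-- `P^i` of a finite sum, on the closed cylinder. [folklore] -/
theorem cylWord_replicate_P_finset_sum (i : ℕ) {ι' : Type*} (s : Finset ι') {f : ι' → ℝ³ → F}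
    (hf : ∀ k ∈ s, ContDiffOn ℝ ∞ (f k) 𝕂) :
    EqOn (cylWord (List.replicate i Pf) (fun x => ∑ k ∈ s, f k x))
      (fun x => ∑ k ∈ s, cylWord (List.replicate i Pf) (f k) x) 𝕂 := by
  classical
  induction s using Finset.induction_on with
  | empty =>
    intro x hx
    simp only [Finset.sum_empty]
    exact cylWord_replicate_P_zero i hx
  | insert k s hk ih =>
    intro x hx
    simp only [Finset.sum_insert hk]
    have hrest : ContDiffOn ℝ ∞ (fun x => ∑ k ∈ s, f k x) 𝕂 := ContDiffOn.sum fun j hj => hf j (Finset.mem_insert_of_mem hj)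
    rw [cylWord_replicate_P_add i (hf k (Finset.mem_insert_self k s)) hrest hx]
    show cylWord (List.replicate i Pf) (f k) x + cylWord (List.replicate i Pf) (fun x => ∑ k ∈ s, f k x) x = _
    rw [ih (fun j hj => hf j (Finset.mem_insert_of_mem hj)) hx]

/-- **`P^i (φ h) = φ Σ_{l ≤ i} c_{i,l} P^l h`** for a coefficient with `P φ = φ` on the closed cylinder
(universal coefficients, vanishing for `l > i`). [folklore] -/
theorem exists_coeff_cylWord_replicate_P_smul (i : ℕ) : ∃ c : ℕ → ℝ, (∀ l, i < l → c l = 0) ∧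
    ∀ {φ : ℝ³ → ℝ}, ContDiffOn ℝ ∞ φ 𝕂 → (∀ x ∈ 𝕂, cylDeriv Pf φ x = φ x) →
      ∀ {h : ℝ³ → F}, ContDiffOn ℝ ∞ h 𝕂 →
        EqOn (cylWord (List.replicate i Pf) (fun y => φ y • h y))
          (fun x => φ x • ∑ l ∈ Finset.range (i + 1), c l • cylWord (List.replicate l Pf) h x) 𝕂 := by
  induction i with
  | zero =>
    refine ⟨fun l => if l = 0 then 1 else 0, fun l hl => if_neg (by omega), fun hφ hPφ h hh x hx => ?_⟩
    simp
  | succ i ih =>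
    obtain ⟨c, hc0, hc⟩ := ih
    refine ⟨fun l => c l + (if l = 0 then 0 else c (l - 1)), fun l hl => ?_, fun {φ} hφ hPφ {h} hh x hx => ?_⟩
    · have h1 : c l = 0 := hc0 l (by omega)
      have h2 : c (l - 1) = 0 := hc0 (l - 1) (by omega)
      simp [h1, h2]
    · have hPl : ∀ l, ContDiffOn ℝ ∞ (cylWord (List.replicate l Pf) h) 𝕂 := fun l =>
        contDiffOn_cylWord (contDiff_of_mem_replicate_P l) hh
      set S : ℝ³ → F := fun x => ∑ l ∈ Finset.range (i + 1), c l • cylWord (List.replicate l Pf) h x with hS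
      have hSs : ContDiffOn ℝ ∞ S 𝕂 := ContDiffOn.sum fun l _ => (hPl l).const_smul _
      rw [List.replicate_succ, cylWord_cons, cylDeriv_congr (hc hφ hPφ hh) hx]
      show cylDeriv Pf (fun y => φ y • S y) x = _
      rw [cylDeriv_smul hφ hSs hx, hPφ x hx]
      have hPS : cylDeriv Pf S x = ∑ l ∈ Finset.range (i + 1), c l • cylWord (List.replicate (l + 1) Pf) h x := by
        rw [hS, cylDeriv_finset_sum _ (fun l _ => (hPl l).const_smul _) hx]
        refine Finset.sum_congr rfl fun l _ => ?_
        rw [cylDeriv_const_smul _ (hPl l) hx, List.replicate_succ, cylWord_cons]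
      have key : S x + ∑ l ∈ Finset.range (i + 1), c l • cylWord (List.replicate (l + 1) Pf) h x =
          ∑ l ∈ Finset.range (i + 1 + 1), (c l + (if l = 0 then 0 else c (l - 1))) • cylWord (List.replicate l Pf) h x := by
        simp only [add_smul, Finset.sum_add_distrib]
        congr 1
        · rw [Finset.sum_range_succ, hc0 (i + 1) (Nat.lt_succ_self i), zero_smul, add_zero]
        · conv_rhs => rw [Finset.sum_range_succ']
          have e0 : (if (0 : ℕ) = 0 then (0 : ℝ) else c (0 - 1)) = 0 := if_pos rfl
          rw [e0, zero_smul, add_zero]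
          refine Finset.sum_congr rfl fun l _ => ?_
          rw [if_neg (Nat.add_one_ne_zero l), Nat.add_sub_cancel]
      rw [hPS, ← smul_add, key]

/-! ### The expansion of `P` in the basis, with eigen-coefficients -/

/-- The horizontal projection is idempotent. [folklore] -/
theorem horizontalProj_horizontalProj' (y : ℝ³) : horizontalProj (horizontalProj y) = horizontalProj y := by
  ext i
  fin_cases i <;> simp [horizontalProj_apply_eq]

/-- The coefficient `ℓ(x_h)` of a linear functional is an eigenfunction of `P`: `P(ℓ ∘ x_h) = ℓ ∘ x_h`.
[folklore] -/
theorem cylDeriv_P_coord_horizontalProj (ℓ : ℝ³ →L[ℝ] ℝ) {x : ℝ³} (hx : x ∈ 𝕂) :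
    cylDeriv Pf (fun y => ℓ (horizontalProj y)) x = ℓ (horizontalProj x) := by
  have hT : DifferentiableAt ℝ (fun y : ℝ³ => ℓ (horizontalProj y)) x :=
    (ℓ.differentiableAt).comp x (contDiff_horizontalProj.differentiable (by simp) x)
  rw [cylDeriv_eq_fderiv_of_differentiableAt hT hx]
  have h1 : fderiv ℝ (fun y : ℝ³ => ℓ (horizontalProj y)) x = ℓ.comp horizontalProjL :=
    (ℓ.hasFDerivAt.comp x (horizontalProjL.hasFDerivAt)).fderiv
  rw [h1, ContinuousLinearMap.comp_apply, horizontalProjL_apply, horizontalProj_horizontalProj']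

/-- The eigen-coefficients are smooth. [folklore] -/
theorem contDiff_coord_horizontalProj (ℓ : ℝ³ →L[ℝ] ℝ) : ContDiff ℝ ∞ fun y : ℝ³ => ℓ (horizontalProj y) :=
  ℓ.contDiff.comp contDiff_horizontalProj

/-- The eigen-coefficients are bounded by `‖ℓ‖` on the closed cylinder (`‖x_h‖ = r ≤ 1`). [folklore] -/
theorem abs_coord_horizontalProj_le (ℓ : ℝ³ →L[ℝ] ℝ) {x : ℝ³} (hx : x ∈ 𝕂) : |ℓ (horizontalProj x)| ≤ ‖ℓ‖ := by
  rw [← Real.norm_eq_abs]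
  refine (ℓ.le_opNorm _).trans ?_
  rw [norm_horizontalProj]
  rw [closure_unitCylinder] at hx
  exact mul_le_of_le_one_right (norm_nonneg _) hx

/-! ### Powers of `P` pointwise by the basis words -/

/-- **Powers of `P` are pointwise combinations of basis words**: for every `a` there is `C` such that
for every `g` smooth on the closed cylinder, every `l ≤ a` and every point of the closed cylinder,
`‖P^l g (x)‖ ≤ C Σ_{m ≤ a} Σ_{w : Fin m → ι} ‖X_{e∘w} g (x)‖` (`e = Module.finBasis ℝ ℝ³`). [folklore] -/
theorem exists_norm_cylWord_replicate_P_le (a : ℕ) :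
    ∃ C : ℝ, 0 ≤ C ∧ ∀ (g : ℝ³ → F), ContDiffOn ℝ ∞ g 𝕂 → ∀ l, l ≤ a → ∀ x ∈ 𝕂,
      ‖cylWord (List.replicate l Pf) g x‖ ≤
        C * ∑ m ∈ Finset.range (a + 1), ∑ w : Fin m → Fin (Module.finrank ℝ ℝ³),
          ‖cylWord (jcWord (constWord fun j => Module.finBasis ℝ ℝ³ (w j))) g x‖ := by
  set ι := Fin (Module.finrank ℝ ℝ³) with hι
  set b : Module.Basis ι ℝ ℝ³ := Module.finBasis ℝ ℝ³ with hb
  set ℓ : ι → (ℝ³ →L[ℝ] ℝ) := fun k => LinearMap.toContinuousLinearMap (b.coord k) with hℓ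
  set Λ : ℝ := ∑ k, ‖ℓ k‖ with hΛ
  have hΛ0 : 0 ≤ Λ := Finset.sum_nonneg fun k _ => norm_nonneg _
  -- the pointwise word sum and its monotonicity properties
  set Pw : ℕ → (ℝ³ → F) → ℝ³ → ℝ := fun n g x => ∑ m ∈ Finset.range (n + 1), ∑ w : Fin m → ι,
    ‖cylWord (jcWord (constWord fun j => b (w j))) g x‖ with hPw
  have hPw0 : ∀ n g x, 0 ≤ Pw n g x := fun n g x =>
    Finset.sum_nonneg fun m _ => Finset.sum_nonneg fun w _ => norm_nonneg _
  have hPwmono : ∀ n g x, Pw n g x ≤ Pw (n + 1) g x := fun n g x => by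
    simp only [hPw]
    rw [Finset.sum_range_succ _ (n + 1)]
    exact le_add_of_nonneg_right (Finset.sum_nonneg fun w _ => norm_nonneg _)
  have hPwderiv : ∀ n g x (k : ι), Pw n (cylDeriv (fun _ => b k) g) x ≤ Pw (n + 1) g x := by
    intro n g x k
    simp only [hPw]
    calc ∑ m ∈ Finset.range (n + 1), ∑ w : Fin m → ι,
          ‖cylWord (jcWord (constWord fun j => b (w j))) (cylDeriv (fun _ => b k) g) x‖
        = ∑ m ∈ Finset.range (n + 1), ∑ w : Fin m → ι,
            ‖cylWord (jcWord (constWord fun j => b ((Fin.cons k w : Fin (m + 1) → ι) j))) g x‖ := by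
          simp only [cylWord_constWord_cylDeriv]
      _ ≤ ∑ m ∈ Finset.range (n + 1), ∑ w' : Fin (m + 1) → ι,
            ‖cylWord (jcWord (constWord fun j => b (w' j))) g x‖ := by
          refine Finset.sum_le_sum fun m _ => ?_
          rw [sum_fin_succ_fun]
          exact Finset.single_le_sum (f := fun k' : ι => ∑ w : Fin m → ι,
            ‖cylWord (jcWord (constWord fun j => b ((Fin.cons k' w : Fin (m + 1) → ι) j))) g x‖)
            (fun _ _ => Finset.sum_nonneg fun w _ => norm_nonneg _) (Finset.mem_univ k)
      _ ≤ ∑ m ∈ Finset.range (n + 1 + 1), ∑ w : Fin m → ι,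
            ‖cylWord (jcWord (constWord fun j => b (w j))) g x‖ := by
          rw [Finset.sum_range_succ' _ (n + 1)]
          exact le_add_of_nonneg_right (Finset.sum_nonneg fun w _ => norm_nonneg _)
  -- induction on `a`
  induction a with
  | zero =>
    refine ⟨1, zero_le_one, fun g _ l hl x _ => ?_⟩
    obtain rfl : l = 0 := by omega
    simp only [List.replicate_zero, cylWord_nil, one_mul, zero_add, Finset.range_one, Finset.sum_singleton]
    rw [sum_fin_zero_fun, constWord_zero, jcWord_nil, cylWord_nil]
  | succ a ih =>
    obtain ⟨C, hC0, hC⟩ := ih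
    obtain ⟨c, -, hc⟩ := exists_coeff_cylWord_replicate_P_smul (F := F) a
    set Sc : ℝ := ∑ l ∈ Finset.range (a + 1), |c l| with hSc
    have hSc0 : 0 ≤ Sc := Finset.sum_nonneg fun l _ => abs_nonneg _
    refine ⟨max C (Λ * Sc * C), le_max_of_le_left hC0, fun g hg l hl x hx => ?_⟩
    have hPwx0 := hPw0 (a + 1) g x
    by_cases hla : l ≤ a
    · calc ‖cylWord (List.replicate l Pf) g x‖ ≤ C * Pw a g x := hC g hg l hla x hx
        _ ≤ C * Pw (a + 1) g x := mul_le_mul_of_nonneg_left (hPwmono a g x) hC0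
        _ ≤ max C (Λ * Sc * C) * Pw (a + 1) g x := mul_le_mul_of_nonneg_right (le_max_left _ _) hPwx0
    · obtain rfl : l = a + 1 := by omega
      -- `P^{a+1} g = P^a (P g)`, `P g = Σ_k ℓ_k(x_h) ∂_{e_k} g`
      have hDk : ∀ k, ContDiffOn ℝ ∞ (cylDeriv (fun _ => b k) g) 𝕂 := fun k => contDiffOn_cylDeriv contDiff_const hg
      have hφs : ∀ k, ContDiffOn ℝ ∞ (fun y : ℝ³ => ℓ k (horizontalProj y)) 𝕂 := fun k =>
        (contDiff_coord_horizontalProj (ℓ k)).contDiffOn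
      have hterm : ∀ k ∈ (Finset.univ : Finset ι), ContDiffOn ℝ ∞ (fun y => ℓ k (horizontalProj y) • cylDeriv (fun _ => b k) g y) 𝕂 :=
        fun k _ => (hφs k).smul (hDk k)
      have hPg : EqOn (cylDeriv Pf g) (fun y => ∑ k, ℓ k (horizontalProj y) • cylDeriv (fun _ => b k) g y) 𝕂 :=
        fun y _ => cylDeriv_eq_sum_coord_mul b Pf g y
      have e1 : cylWord (List.replicate (a + 1) Pf) g x =
          ∑ k, cylWord (List.replicate a Pf) (fun y => ℓ k (horizontalProj y) • cylDeriv (fun _ => b k) g y) x := by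
        rw [List.replicate_succ', cylWord_append]
        have h1 : cylWord [Pf] g = cylDeriv Pf g := rfl
        rw [h1, cylWord_congr _ hPg hx]
        exact cylWord_replicate_P_finset_sum a Finset.univ hterm hx
      have e2 : ∀ k, cylWord (List.replicate a Pf) (fun y => ℓ k (horizontalProj y) • cylDeriv (fun _ => b k) g y) x =
          ℓ k (horizontalProj x) • ∑ l ∈ Finset.range (a + 1), c l • cylWord (List.replicate l Pf) (cylDeriv (fun _ => b k) g) x :=
        fun k => hc (hφs k) (fun y hy => cylDeriv_P_coord_horizontalProj (ℓ k) hy) (hDk k) hx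
      rw [e1]
      simp only [e2]
      calc ‖∑ k, ℓ k (horizontalProj x) • ∑ l ∈ Finset.range (a + 1), c l • cylWord (List.replicate l Pf) (cylDeriv (fun _ => b k) g) x‖
          ≤ ∑ k, ‖ℓ k‖ * ∑ l ∈ Finset.range (a + 1), |c l| * ‖cylWord (List.replicate l Pf) (cylDeriv (fun _ => b k) g) x‖ := by
            refine (norm_sum_le _ _).trans (Finset.sum_le_sum fun k _ => ?_)
            rw [norm_smul, Real.norm_eq_abs]
            refine mul_le_mul (abs_coord_horizontalProj_le (ℓ k) hx) ?_ (norm_nonneg _) (norm_nonneg _)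
            refine (norm_sum_le _ _).trans (Finset.sum_le_sum fun l _ => ?_)
            rw [norm_smul, Real.norm_eq_abs]
        _ ≤ ∑ k, ‖ℓ k‖ * ∑ l ∈ Finset.range (a + 1), |c l| * (C * Pw (a + 1) g x) := by
            refine Finset.sum_le_sum fun k _ => mul_le_mul_of_nonneg_left ?_ (norm_nonneg _)
            refine Finset.sum_le_sum fun l hl => mul_le_mul_of_nonneg_left ?_ (abs_nonneg _)
            have hl' := Finset.mem_range.1 hl
            exact (hC _ (hDk k) l (by omega) x hx).trans (mul_le_mul_of_nonneg_left (hPwderiv a g x k) hC0)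
        _ = Λ * Sc * C * Pw (a + 1) g x := by
            rw [hΛ, hSc, ← Finset.sum_mul, ← Finset.sum_mul]
            ring
        _ ≤ max C (Λ * Sc * C) * Pw (a + 1) g x := mul_le_mul_of_nonneg_right (le_max_right _ _) hPwx0

/-- The pointwise bound with one constant for all `a ≤ N`. [folklore] -/
theorem exists_norm_cylWord_replicate_P_le_all (N : ℕ) :
    ∃ C : ℝ, 0 ≤ C ∧ ∀ a, a ≤ N → ∀ (g : ℝ³ → F), ContDiffOn ℝ ∞ g 𝕂 → ∀ l, l ≤ a → ∀ x ∈ 𝕂,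
      ‖cylWord (List.replicate l Pf) g x‖ ≤
        C * ∑ m ∈ Finset.range (a + 1), ∑ w : Fin m → Fin (Module.finrank ℝ ℝ³),
          ‖cylWord (jcWord (constWord fun j => Module.finBasis ℝ ℝ³ (w j))) g x‖ := by
  induction N with
  | zero =>
    obtain ⟨C, hC0, hC⟩ := exists_norm_cylWord_replicate_P_le (F := F) 0
    refine ⟨C, hC0, fun a ha => ?_⟩
    obtain rfl : a = 0 := by omega
    exact hC
  | succ N ih =>
    obtain ⟨C₁, hC₁0, hC₁⟩ := ih
    obtain ⟨C₂, hC₂0, hC₂⟩ := exists_norm_cylWord_replicate_P_le (F := F) (N + 1)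
    refine ⟨max C₁ C₂, le_max_of_le_left hC₁0, fun a ha g hg l hl x hx => ?_⟩
    have hS0 : 0 ≤ ∑ m ∈ Finset.range (a + 1), ∑ w : Fin m → Fin (Module.finrank ℝ ℝ³),
        ‖cylWord (jcWord (constWord fun j => Module.finBasis ℝ ℝ³ (w j))) g x‖ :=
      Finset.sum_nonneg fun m _ => Finset.sum_nonneg fun w _ => norm_nonneg _
    rcases Nat.lt_or_ge a (N + 1) with hlt | hge
    · exact (hC₁ a (by omega) g hg l hl x hx).trans (mul_le_mul_of_nonneg_right (le_max_left _ _) hS0)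
    · obtain rfl : a = N + 1 := by omega
      exact (hC₂ g hg l hl x hx).trans (mul_le_mul_of_nonneg_right (le_max_right _ _) hS0)

/-! ### `P^a` of a word over `{J} ∪ {constants}` by the word sum -/

/-- Constants of the tree's word bound, uniformly for all lengths `≤ N`. [folklore] -/
theorem exists_cellL2_cylWord_jcWord_le_all (L : ℝ) {M : ℝ} (hM1 : 1 ≤ M)
    (hMb : ∀ k, ‖Module.finBasis ℝ ℝ³ k‖ ≤ M) (N : ℕ) :
    ∃ K : ℝ, 0 ≤ K ∧ ∀ n, n ≤ N → ∀ (wd : List (Option ℝ³)), wd.length = n →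
      (∀ v, some v ∈ wd → ‖v‖ ≤ M) → ∀ (g : ℝ³ → F), ContDiffOn ℝ ∞ g 𝕂 →
        cellL2 L (cylWord (jcWord wd) g) ≤
          K * M ^ n * ∑ m ∈ Finset.range (n + 1), ∑ w : Fin m → Fin (Module.finrank ℝ ℝ³),
            cellL2 L (cylWord (jcWord (constWord fun j => Module.finBasis ℝ ℝ³ (w j))) g) := by
  induction N with
  | zero =>
    obtain ⟨K, hK0, hK⟩ := exists_cellL2_cylWord_jcWord_le (F := F) L hM1 hMb 0
    refine ⟨K, hK0, fun n hn => ?_⟩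
    obtain rfl : n = 0 := by omega
    exact hK
  | succ N ih =>
    obtain ⟨K₁, hK₁0, hK₁⟩ := ih
    obtain ⟨K₂, hK₂0, hK₂⟩ := exists_cellL2_cylWord_jcWord_le (F := F) L hM1 hMb (N + 1)
    refine ⟨max K₁ K₂, le_max_of_le_left hK₁0, fun n hn wd hwd hl g hg => ?_⟩
    have hS0 : 0 ≤ M ^ n * ∑ m ∈ Finset.range (n + 1), ∑ w : Fin m → Fin (Module.finrank ℝ ℝ³),
        cellL2 L (cylWord (jcWord (constWord fun j => Module.finBasis ℝ ℝ³ (w j))) g) :=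
      mul_nonneg (by positivity) (Finset.sum_nonneg fun m _ => Finset.sum_nonneg fun w _ => cellL2_nonneg L _)
    rcases Nat.lt_or_ge n (N + 1) with hlt | hge
    · refine (hK₁ n (by omega) wd hwd hl g hg).trans ?_
      rw [mul_assoc, mul_assoc]
      exact mul_le_mul_of_nonneg_right (le_max_left _ _) hS0
    · obtain rfl : n = N + 1 := by omega
      refine (hK₂ wd hwd hl g hg).trans ?_
      rw [mul_assoc, mul_assoc]
      exact mul_le_mul_of_nonneg_right (le_max_right _ _) hS0

/-- **`‖P^a X_{wd} f‖_{L²(cell)} ≤ C M^N 𝒩_N(f)`** for words `wd` over `{J} ∪ {constants of norm ≤ M}`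
with `a + |wd| ≤ N`. [folklore] -/
theorem exists_cellL2_replicate_P_jcWord_le (L : ℝ) {M : ℝ} (hM1 : 1 ≤ M)
    (hMb : ∀ k, ‖Module.finBasis ℝ ℝ³ k‖ ≤ M) (N : ℕ) :
    ∃ C : ℝ, 0 ≤ C ∧ ∀ (a : ℕ) (wd : List (Option ℝ³)), a + wd.length ≤ N →
      (∀ v, some v ∈ wd → ‖v‖ ≤ M) → ∀ (f : ℝ³ → F), ContDiffOn ℝ ∞ f 𝕂 →
        cellL2 L (cylWord (List.replicate a Pf) (cylWord (jcWord wd) f)) ≤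
          C * M ^ N * ∑ m ∈ Finset.range (N + 1), ∑ w : Fin m → Fin (Module.finrank ℝ ℝ³),
            cellL2 L (cylWord (jcWord (constWord fun j => Module.finBasis ℝ ℝ³ (w j))) f) := by
  set ι := Fin (Module.finrank ℝ ℝ³) with hι
  set b : Module.Basis ι ℝ ℝ³ := Module.finBasis ℝ ℝ³ with hb
  have hM0 : 0 ≤ M := zero_le_one.trans hM1
  obtain ⟨C₁, hC₁0, hC₁⟩ := exists_norm_cylWord_replicate_P_le_all (F := F) N
  obtain ⟨K, hK0, hK⟩ := exists_cellL2_cylWord_jcWord_le_all (F := F) L hM1 hMb N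
  -- the word sum and its monotonicity
  set 𝒩 : ℕ → (ℝ³ → F) → ℝ := fun n g => ∑ m ∈ Finset.range (n + 1), ∑ w : Fin m → ι,
    cellL2 L (cylWord (jcWord (constWord fun j => b (w j))) g) with h𝒩
  have h𝒩0 : ∀ n g, 0 ≤ 𝒩 n g := fun n g => Finset.sum_nonneg fun m _ => Finset.sum_nonneg fun w _ => cellL2_nonneg L _
  have h𝒩mono : ∀ {n n'} (g), n ≤ n' → 𝒩 n g ≤ 𝒩 n' g := fun {n n'} g h => by
    simp only [h𝒩]
    exact Finset.sum_le_sum_of_subset_of_nonneg (Finset.range_mono (by omega))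
      fun _ _ _ => Finset.sum_nonneg fun w _ => cellL2_nonneg L _
  -- the number of pointwise terms
  set T : ℝ := ∑ m ∈ Finset.range (N + 1), (Fintype.card (Fin m → ι) : ℝ) with hT
  have hT0 : 0 ≤ T := Finset.sum_nonneg fun m _ => by positivity
  refine ⟨C₁ * T * K, by positivity, fun a wd hlen hl f hf => ?_⟩
  set g : ℝ³ → F := cylWord (jcWord wd) f with hg
  have hgs : ContDiffOn ℝ ∞ g 𝕂 := contDiffOn_cylWord_jcWord wd hf
  have ha : a ≤ N := by omega
  -- pointwise, then `cellL2`
  have hpt : ∀ x ∈ (cylinderCell L : Set ℝ³), ‖cylWord (List.replicate a Pf) g x‖ ≤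
      ‖C₁ * ∑ m ∈ Finset.range (a + 1), ∑ w : Fin m → ι, ‖cylWord (jcWord (constWord fun j => b (w j))) g x‖‖ := by
    intro x hx
    have hxK : x ∈ 𝕂 := subset_closure (cylinderCell_le_unitCylinder L hx)
    rw [Real.norm_of_nonneg (mul_nonneg hC₁0 (Finset.sum_nonneg fun m _ => Finset.sum_nonneg fun w _ => norm_nonneg _))]
    exact hC₁ a ha g hgs a le_rfl x hxK
  have hwc : ∀ (m : ℕ) (w : Fin m → ι), ContinuousOn (fun x => ‖cylWord (jcWord (constWord fun j => b (w j))) g x‖) 𝕂 :=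
    fun m w => (contDiffOn_cylWord_jcWord _ hgs).continuousOn.norm
  have hcont : ContinuousOn (fun x => C₁ * ∑ m ∈ Finset.range (a + 1), ∑ w : Fin m → ι,
      ‖cylWord (jcWord (constWord fun j => b (w j))) g x‖) 𝕂 :=
    continuousOn_const.mul (continuousOn_finsetSum _ fun m _ => continuousOn_finsetSum _ fun w _ => hwc m w)
  -- each word of `g` of length `m ≤ a` is a word of `f` of length `m + |wd| ≤ N`
  have hword : ∀ (m : ℕ) (w : Fin m → ι), m ≤ a →
      cellL2 L (cylWord (jcWord (constWord fun j => b (w j))) g) ≤ K * M ^ N * 𝒩 N f := by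
    intro m w hm
    have hmN : m + wd.length ≤ N := by omega
    have e1 : cylWord (jcWord (constWord fun j => b (w j))) g = cylWord (jcWord (constWord (fun j => b (w j)) ++ wd)) f := by
      rw [hg, jcWord_append, cylWord_append]
    rw [e1]
    have hlen' : (constWord (fun j => b (w j)) ++ wd).length = m + wd.length := by simp
    have hlet : ∀ v, some v ∈ constWord (fun j => b (w j)) ++ wd → ‖v‖ ≤ M := by
      intro v hv
      rcases List.mem_append.1 hv with h | h
      · simp only [constWord, List.mem_map, List.mem_reverse, List.mem_ofFn] at h
        obtain ⟨_, ⟨j, rfl⟩, hj⟩ := h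
        rw [Option.some.injEq] at hj
        rw [← hj]; exact hMb _
      · exact hl v h
    refine (hK (m + wd.length) hmN _ hlen' hlet f hf).trans ?_
    have h1 : M ^ (m + wd.length) ≤ M ^ N := pow_le_pow_right₀ hM1 hmN
    have h2 := h𝒩mono f hmN
    have h3 := h𝒩0 (m + wd.length) f
    calc K * M ^ (m + wd.length) * 𝒩 (m + wd.length) f ≤ K * M ^ N * 𝒩 (m + wd.length) f := by gcongr
      _ ≤ K * M ^ N * 𝒩 N f := by gcongr
  calc cellL2 L (cylWord (List.replicate a Pf) g)
      ≤ cellL2 L (fun x => C₁ * ∑ m ∈ Finset.range (a + 1), ∑ w : Fin m → ι,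
          ‖cylWord (jcWord (constWord fun j => b (w j))) g x‖) := cellL2_mono L hcont hpt
    _ = C₁ * cellL2 L (fun x => ∑ m ∈ Finset.range (a + 1), ∑ w : Fin m → ι,
          ‖cylWord (jcWord (constWord fun j => b (w j))) g x‖) := cellL2_const_mul L hC₁0 _
    _ ≤ C₁ * ∑ m ∈ Finset.range (a + 1), ∑ w : Fin m → ι,
          cellL2 L (fun x => ‖cylWord (jcWord (constWord fun j => b (w j))) g x‖) := by
        refine mul_le_mul_of_nonneg_left ?_ hC₁0
        refine (cellL2_sum_le L _ fun m _ => continuousOn_finsetSum _ fun w _ => hwc m w).trans ?_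
        exact Finset.sum_le_sum fun m _ => cellL2_sum_le L _ fun w _ => hwc m w
    _ ≤ C₁ * ∑ m ∈ Finset.range (a + 1), ∑ _w : Fin m → ι, K * M ^ N * 𝒩 N f := by
        refine mul_le_mul_of_nonneg_left (Finset.sum_le_sum fun m hm => Finset.sum_le_sum fun w _ => ?_) hC₁0
        rw [cellL2_norm]
        exact hword m w (by have := Finset.mem_range.1 hm; omega)
    _ ≤ C₁ * ∑ m ∈ Finset.range (N + 1), ∑ _w : Fin m → ι, K * M ^ N * 𝒩 N f := by
        refine mul_le_mul_of_nonneg_left ?_ hC₁0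
        refine Finset.sum_le_sum_of_subset_of_nonneg (Finset.range_mono (by omega)) fun m _ _ => ?_
        exact Finset.sum_nonneg fun w _ => mul_nonneg (by positivity) (h𝒩0 N f)
    _ = C₁ * T * K * (M ^ N * 𝒩 N f) := by
        simp only [hT, Finset.sum_const, Finset.card_univ, nsmul_eq_mul, Finset.sum_mul, Finset.mul_sum]
        refine Finset.sum_congr rfl fun m _ => ?_
        ring
    _ = C₁ * T * K * M ^ N * 𝒩 N f := by ring

/-! ### The sizes of `PeriodicCylinderNeumannFrameWordsAll` by the word sums -/

/-- The sorted frame word `P^a J^j E^e` is `P^a` of a word over `{J} ∪ {constants}` (`E = ∂_{e₂}`, a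
constant letter of norm `1`). [folklore] -/
theorem cylWord_pje_eq_replicate_jcWord (a j e : ℕ) (f : ℝ³ → F) :
    cylWord pje[a, j, e] f = cylWord (List.replicate a Pf)
      (cylWord (jcWord (List.replicate j (none : Option ℝ³) ++ List.replicate e (some (cylBasis 2)))) f) := by
  rw [List.append_assoc, cylWord_append]
  congr 1
  have h : jcWord (List.replicate j (none : Option ℝ³) ++ List.replicate e (some (cylBasis 2))) =
      List.replicate j rotGen ++ List.replicate e Ef := by
    simp [jcWord, List.map_append, List.map_replicate]
  rw [h]

/-- The letters of that word have norm at most `1`. [folklore] -/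
theorem norm_le_of_mem_replicate_jcWord (j e : ℕ) {M : ℝ} (hM1 : 1 ≤ M) {v : ℝ³}
    (hv : some v ∈ List.replicate j (none : Option ℝ³) ++ List.replicate e (some (cylBasis 2))) : ‖v‖ ≤ M := by
  rcases List.mem_append.1 hv with h | h
  · exact absurd (List.eq_of_mem_replicate h) (Option.some_ne_none v)
  · have h2 := List.eq_of_mem_replicate h
    rw [Option.some.injEq] at h2
    rw [h2, norm_cylBasis]; exact hM1

/-- **The frame size by the Sobolev word sum**: for `L` and every `n` there is `C` with
`frameSize n f ≤ C 𝒩_n(f)` for all `f` smooth on the closed cylinder. [folklore] -/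
theorem exists_frameSize_le_wordSum (L : ℝ) (n : ℕ) :
    ∃ C : ℝ, 0 ≤ C ∧ ∀ (f : ℝ³ → F), ContDiffOn ℝ ∞ f 𝕂 →
      frameSize L n f ≤ C * ∑ m ∈ Finset.range (n + 1), ∑ w : Fin m → Fin (Module.finrank ℝ ℝ³),
        cellL2 L (cylWord (jcWord (constWord fun j => Module.finBasis ℝ ℝ³ (w j))) f) := by
  obtain ⟨M, hM⟩ : ∃ M : ℝ, M = 1 + ∑ k, ‖Module.finBasis ℝ ℝ³ k‖ := ⟨_, rfl⟩
  have hM1 : 1 ≤ M := by rw [hM]; exact le_add_of_nonneg_right (Finset.sum_nonneg fun k _ => norm_nonneg _)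
  have hMb : ∀ k, ‖Module.finBasis ℝ ℝ³ k‖ ≤ M := fun k => by
    rw [hM]
    exact (Finset.single_le_sum (f := fun k => ‖Module.finBasis ℝ ℝ³ k‖) (fun _ _ => norm_nonneg _)
      (Finset.mem_univ k)).trans (le_add_of_nonneg_left zero_le_one)
  obtain ⟨C, hC0, hC⟩ := exists_cellL2_replicate_P_jcWord_le (F := F) L hM1 hMb n
  obtain ⟨Tn, hTn⟩ : ∃ T : ℝ, T = ∑ k ∈ Finset.range (n + 1), ∑ p ∈ Finset.HasAntidiagonal.antidiagonal k,
      ∑ _p' ∈ Finset.HasAntidiagonal.antidiagonal p.2, (1 : ℝ) := ⟨_, rfl⟩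
  have hTn0 : 0 ≤ Tn := by
    rw [hTn]
    exact Finset.sum_nonneg fun _ _ => Finset.sum_nonneg fun _ _ => Finset.sum_nonneg fun _ _ => zero_le_one
  refine ⟨Tn * (C * M ^ n), by positivity, fun f hf => ?_⟩
  have hterm : ∀ l j e : ℕ, l + j + e ≤ n → cellL2 L (cylWord pje[l, j, e] f) ≤
      C * M ^ n * ∑ m ∈ Finset.range (n + 1), ∑ w : Fin m → Fin (Module.finrank ℝ ℝ³),
        cellL2 L (cylWord (jcWord (constWord fun j => Module.finBasis ℝ ℝ³ (w j))) f) := by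
    intro l j e hle
    rw [cylWord_pje_eq_replicate_jcWord]
    exact hC l _ (by rw [List.length_append, List.length_replicate, List.length_replicate]; omega)
      (fun v hv => norm_le_of_mem_replicate_jcWord j e hM1 hv) f hf
  have hsum : frameSize L n f ≤ ∑ k ∈ Finset.range (n + 1), ∑ p ∈ Finset.HasAntidiagonal.antidiagonal k,
      ∑ _p' ∈ Finset.HasAntidiagonal.antidiagonal p.2,
        C * M ^ n * ∑ m ∈ Finset.range (n + 1), ∑ w : Fin m → Fin (Module.finrank ℝ ℝ³),
          cellL2 L (cylWord (jcWord (constWord fun j => Module.finBasis ℝ ℝ³ (w j))) f) := by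
    rw [frameSize]
    refine Finset.sum_le_sum fun k hk => Finset.sum_le_sum fun p hp => Finset.sum_le_sum fun p' hp' => ?_
    have hk' := Finset.mem_range.1 hk
    have hp1 := Finset.HasAntidiagonal.mem_antidiagonal.1 hp
    have hp2 := Finset.HasAntidiagonal.mem_antidiagonal.1 hp'
    exact hterm p.1 p'.1 p'.2 (by omega)
  refine hsum.trans (le_of_eq ?_)
  rw [hTn, Finset.sum_mul, Finset.sum_mul]
  refine Finset.sum_congr rfl fun k _ => ?_
  rw [Finset.sum_mul, Finset.sum_mul]
  refine Finset.sum_congr rfl fun p _ => ?_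
  rw [Finset.sum_mul, Finset.sum_mul]
  refine Finset.sum_congr rfl fun p' _ => ?_
  ring

/-- **The tangential size by the Sobolev word sum**: for `L` and every `n` there is `C` with
`tanSize n f ≤ C 𝒩_{n+1}(f)` for all real `f` smooth on the closed cylinder (`‖∇g‖ ≤ Σᵢ ‖∂ᵢ g‖`, and
`∂ᵢ J^j E^e f` is a word over the alphabet of length `j + e + 1`). [folklore] -/
theorem exists_tanSize_le_wordSum (L : ℝ) (n : ℕ) :
    ∃ C : ℝ, 0 ≤ C ∧ ∀ (f : ℝ³ → ℝ), ContDiffOn ℝ ∞ f 𝕂 →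
      tanSize L n f ≤ C * ∑ m ∈ Finset.range (n + 2), ∑ w : Fin m → Fin (Module.finrank ℝ ℝ³),
        cellL2 L (cylWord (jcWord (constWord fun j => Module.finBasis ℝ ℝ³ (w j))) f) := by
  obtain ⟨M, hM⟩ : ∃ M : ℝ, M = 1 + ∑ k, ‖Module.finBasis ℝ ℝ³ k‖ := ⟨_, rfl⟩
  have hM1 : 1 ≤ M := by rw [hM]; exact le_add_of_nonneg_right (Finset.sum_nonneg fun k _ => norm_nonneg _)
  have hMb : ∀ k, ‖Module.finBasis ℝ ℝ³ k‖ ≤ M := fun k => by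
    rw [hM]
    exact (Finset.single_le_sum (f := fun k => ‖Module.finBasis ℝ ℝ³ k‖) (fun _ _ => norm_nonneg _)
      (Finset.mem_univ k)).trans (le_add_of_nonneg_left zero_le_one)
  obtain ⟨C, hC0, hC⟩ := exists_cellL2_replicate_P_jcWord_le (F := ℝ) L hM1 hMb (n + 1)
  obtain ⟨Tn, hTn⟩ : ∃ T : ℝ, T = ∑ k ∈ Finset.range (n + 1),
      ∑ _p ∈ Finset.HasAntidiagonal.antidiagonal k, (3 : ℝ) := ⟨_, rfl⟩
  have hTn0 : 0 ≤ Tn := by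
    rw [hTn]; exact Finset.sum_nonneg fun _ _ => Finset.sum_nonneg fun _ _ => by norm_num
  refine ⟨Tn * (C * M ^ (n + 1)), by positivity, fun f hf => ?_⟩
  -- one word
  have hterm : ∀ j e : ℕ, j + e ≤ n → cellL2 L (cylGrad (cylWord pje[0, j, e] f)) ≤
      3 * (C * M ^ (n + 1) * ∑ m ∈ Finset.range (n + 2), ∑ w : Fin m → Fin (Module.finrank ℝ ℝ³),
        cellL2 L (cylWord (jcWord (constWord fun j => Module.finBasis ℝ ℝ³ (w j))) f)) := by
    intro j e hje
    have hws : ContDiffOn ℝ ∞ (cylWord pje[0, j, e] f) 𝕂 := contDiffOn_cylWord_pje 0 j e hf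
    refine (cellL2_cylGrad_le_sum L hws).trans ?_
    have h3 : ∀ i : Fin 3, cellL2 L (cylDeriv (fun _ => cylBasis i) (cylWord pje[0, j, e] f)) ≤
        C * M ^ (n + 1) * ∑ m ∈ Finset.range (n + 2), ∑ w : Fin m → Fin (Module.finrank ℝ ℝ³),
          cellL2 L (cylWord (jcWord (constWord fun j => Module.finBasis ℝ ℝ³ (w j))) f) := by
      intro i
      have e1 : cylDeriv (fun _ => cylBasis i) (cylWord pje[0, j, e] f) = cylWord (List.replicate 0 Pf)
          (cylWord (jcWord (some (cylBasis i) :: (List.replicate j (none : Option ℝ³) ++ List.replicate e (some (cylBasis 2))))) f) := by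
        rw [cylWord_pje_eq_replicate_jcWord, List.replicate_zero, cylWord_nil, cylWord_nil, jcWord_cons, cylWord_cons, jcField_some]
      rw [e1]
      refine hC 0 _ (by rw [List.length_cons, List.length_append, List.length_replicate, List.length_replicate]; omega)
        (fun v hv => ?_) f hf
      rcases List.mem_cons.1 hv with h | h
      · rw [Option.some.injEq] at h; rw [h, norm_cylBasis]; exact hM1
      · exact norm_le_of_mem_replicate_jcWord j e hM1 h
    calc ∑ i : Fin 3, cellL2 L (cylDeriv (fun _ => cylBasis i) (cylWord pje[0, j, e] f))
        ≤ ∑ _i : Fin 3, C * M ^ (n + 1) * ∑ m ∈ Finset.range (n + 2), ∑ w : Fin m → Fin (Module.finrank ℝ ℝ³),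
            cellL2 L (cylWord (jcWord (constWord fun j => Module.finBasis ℝ ℝ³ (w j))) f) :=
          Finset.sum_le_sum fun i _ => h3 i
      _ = 3 * (C * M ^ (n + 1) * ∑ m ∈ Finset.range (n + 2), ∑ w : Fin m → Fin (Module.finrank ℝ ℝ³),
            cellL2 L (cylWord (jcWord (constWord fun j => Module.finBasis ℝ ℝ³ (w j))) f)) := by
          rw [Finset.sum_const, Finset.card_univ, Fintype.card_fin, nsmul_eq_mul]; push_cast; ring
  have hsum : tanSize L n f ≤ ∑ k ∈ Finset.range (n + 1), ∑ _p ∈ Finset.HasAntidiagonal.antidiagonal k,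
      3 * (C * M ^ (n + 1) * ∑ m ∈ Finset.range (n + 2), ∑ w : Fin m → Fin (Module.finrank ℝ ℝ³),
        cellL2 L (cylWord (jcWord (constWord fun j => Module.finBasis ℝ ℝ³ (w j))) f)) := by
    rw [tanSize]
    refine Finset.sum_le_sum fun k hk => Finset.sum_le_sum fun p hp => ?_
    have hk' := Finset.mem_range.1 hk
    have hp1 := Finset.HasAntidiagonal.mem_antidiagonal.1 hp
    exact hterm p.1 p.2 (by omega)
  refine hsum.trans (le_of_eq ?_)
  rw [hTn, Finset.sum_mul, Finset.sum_mul]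
  refine Finset.sum_congr rfl fun k _ => ?_
  rw [Finset.sum_mul, Finset.sum_mul]
  refine Finset.sum_congr rfl fun p _ => ?_
  ring

end Literature.Analysis.FluidPDE
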